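import Literature.NumberTheory.Sieve.HeathBrownCubicTypeII
import Mathlib.MeasureTheory.Integral.Prod
import Mathlib.MeasureTheory.Integral.Pi
import Mathlib.MeasureTheory.Integral.DominatedConvergence
import Mathlib.MeasureTheory.Integral.IntervalIntegral.FundThmCalculus
import Mathlib.Analysis.SpecialFunctions.Integrals.Basic
import Mathlib.Analysis.Calculus.FDeriv.Measurable
import HarnessLib

/-!
# The calculus of Heath-Brown's weight `w(t, 𝐦)`: Fubini, the right derivative `w'`, (8.3) and (8.4)

Pure-proof file (no definitions) in the decomposition of **parity.S18**
(`Literature.NumberTheory.Sieve.setOf_prime_cube_add_two_mul_cube_infinite`) along D. R. Heath-Brown,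
*Primes represented by `x³ + 2y³`*, Acta Math. 186 (2001), 1–84. The layer `HeathBrownCubicTypeII`
models the function `w(t) = w(t, 𝐦) = meas{𝐱 ∈ ℝ^{n+1} : x_i ∈ J(m_i), ∏ x_i ≤ t}` of (3.12)
(`wMeas X τ m t`, Lebesgue measure of a sub-box of `∏ J(m_i)`, `J(m) = [X^{mξ}, X^{(m+1)ξ})`) and its
right-hand derivative `w'(t)` (`wDeriv X τ m t = derivWithin (wMeas X τ m) (Ioi t) t`, "for the case
`n = 0` … we define the derivative `w'(t)` to be the right-hand derivative, for precision", p. 18),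
through which the leading part `e_S` ((3.12)) of the Type II weights is defined. The proofs of
Lemma 3.8 (§8, pp. 47–50) and Lemma 3.9 (§10, pp. 60–66) use the following calculus of `w`, which
this file PROVES for the tree's `wMeas`/`wDeriv`:

* (p. 48) `w(t) = ∫ ψ(t/∏_{i≤n} x_i) dx_1⋯dx_n` over `∏_{i≤n} J(m_i)`, `ψ(u) = meas{y ∈ J(m_{n+1}) : y ≤ u}`,
  and `w'(t) = ∫_{∏_{i≤n} J(m_i)} (∏x_i)⁻¹ 1[t/∏x_i ∈ J(m_{n+1})] dx` — here `wMeas_eq_integral`,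
  **`hasDerivWithinAt_wMeas`** (`w` has right derivative `w'` at every `t`), **`wDeriv_eq_integral`**;
* **(8.4)** "`0 ≤ w'(t) ≤ (ξ log X)^n`, since `∫_{J(m)} dx/x = ξ log X`" — `wDeriv_nonneg`, `wDeriv_le`;
* **(8.3)** "`|w'(t+h) − w'(t)| ≤ (h/t) ∫_{𝐱∈∏_{i<n}J(m_i)} d𝐱/∏x_i ≪ (h/t)(ξ log X)^{n−1}`" for `n ≥ 1` —
  `abs_wDeriv_sub_wDeriv_le_log`, `abs_wDeriv_sub_wDeriv_le` (with the explicit constant `2`: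
  `|w'(t') − w'(t)| ≤ 2 log(t'/t)(ξ log X)^{n−1} ≤ 2((t'−t)/t)(ξ log X)^{n−1}` for `0 < t ≤ t'`);
* (p. 49) for `n = 0`, "`w'(t, 𝐦)` is just the characteristic function of `J(m_1)` (since we chose the
  right-hand derivative, this is correct even at the endpoints of the interval)" — `wDeriv_eq_indicator`;
* the mean-value step of p. 65 ("When `n ≥ 1` the Mean Value Theorem shows that
  `w(3X³(1+η)/N(R)) − w(3X³/N(R)) = (3ηX³/N(R)) w'(λ)` … We may then use (8.3)", and for `n = 0`
  "A little thought reveals that `w(3X³(1+η)/N(R)) − w(3X³/N(R)) = (3ηX³/N(R)) w'(3X³/N(R))` unless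
  one of the endpoints of `J(m_1)` lies in the interval between") — through the fundamental theorem of
  calculus for right derivatives: `continuous_wMeas`, `wMeas_sub_wMeas_eq_integral`
  (`w(t₂) − w(t₁) = ∫_{t₁}^{t₂} w'`), **`abs_wMeas_sub_sub_mul_wDeriv_le`**
  (`|w(t') − w(t) − (t'−t)w'(t)| ≤ 2((t'−t)²/t)(ξ log X)^{n−1}`, `n ≥ 1`),
  `abs_wMeas_sub_sub_mul_wDeriv_le_of_one`, `wMeas_sub_wMeas_eq_mul_wDeriv_of_one` (`n = 0`).

Everything is first proved for a general box `∏_{i≤j} [a_i, b_i)` with positive lower corners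
(section `GeneralBox`: `volume_boxLE_eq_lintegral`, `toReal_volume_boxLE_eq_integral`,
`hasDerivWithinAt_integral_sliceFn`, `integral_windowFn_le`, `integral_box_mulWindow_le`,
`abs_integral_windowFn_sub_le`) — also the shape of `meas(J(Y, m))` in Lemma 4.10 — and then
specialised to `J(m_i) = [X^{m_iξ}, X^{(m_i+1)ξ})` (section `HB`). Lengths are written `n + 1`
(resp. `n + 2` where the paper needs `n ≥ 1`), so the paper's exponent `n − 1` in (8.3) reads `n`
in `abs_wDeriv_sub_wDeriv_le`.

## Method

Tonelli on the last coordinate (`lintegral_box_eq_lintegral_snoc`, through Mathlib's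
`measurePreserving_piFinSuccAbove` and `Measure.restrict_pi_pi`) expresses `w(t)` as the integral
of the slice length `ψ(t/∏x')`, `ψ(u) = max 0 (min u d − c)` for the last interval `[c, d)`; `ψ` is
`1`-Lipschitz with right derivative `1_{[c,d)}` everywhere (`hasDerivWithinAt_clamp`), so dominated
convergence (`tendsto_integral_filter_of_dominated_convergence` along `𝓝[>] t`) gives the right
derivative of `w` at EVERY `t` and for EVERY length, including `n = 0`, where `w` is a clamp and is
not differentiable at the two endpoints; (8.4) is `1_{[c,d)} ≤ 1` with
`∫_{box} ∏ x_i⁻¹ = ∏ log(b_i/a_i)` (`integral_fintype_prod_eq_prod`, `integral_inv_of_pos`); (8.3)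
compares the window indicators at `t ≤ t'` (they differ only if `∏x'` lies in `(t/c, t'/c]` or
`(t/d, t'/d]`, `abs_window_sub_window_le`) and bounds the `dx/x`-mass of a multiplicative window by
one more Tonelli step (`lintegral_box_mulWindow_le`: `≤ log(t'/t) ∏_{i<j} log(b_i/a_i)`); the
mean-value statements follow from `intervalIntegral.integral_eq_sub_of_hasDeriv_right_of_le`
(FTC for a continuous function with a right derivative), `w` being Lipschitz
(`abs_wMeas_sub_wMeas_le`) and `w'` measurable (`measurable_derivWithin_Ioi`) and bounded.

What is NOT here: (8.5) and the counting near the boundary (Lemma 4.9); two-sided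
differentiability of `w` for `n ≥ 1` (true, not needed); anything about `e_S`, `f_S`.

## References

* D. R. Heath-Brown, *Primes represented by `x³ + 2y³`*, Acta Math. 186 (2001), 1–84: (3.12) and
  p. 18 (definition of `w`, right-hand derivative), §8 p. 48 ((8.3), (8.4) and the integral formula
  for `w'`), p. 49 (`n = 0`), §10 pp. 64–65 (the mean value step). [cite: HeathBrownActa2001, §8 (8.3)–(8.4)]

## Mathlib / tree search

Mathlib has no ready-made "measure of a sub-level set of the product map in a box" nor its
derivative in the level; used `MeasureTheory.measurePreserving_piFinSuccAbove`,
`Measure.restrict_pi_pi`, `Measure.pi_of_empty`, `lintegral_prod_symm`, `Fin.snoc`/`Fin.prod_snoc`/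
`Fin.insertNth_last'`, `Real.volume_Icc/Ico/pi_Ico`, `integral_eq_lintegral_of_nonneg_ae`,
`ofReal_integral_eq_lintegral_ofReal`, `tendsto_integral_filter_of_dominated_convergence`,
`hasDerivWithinAt_iff_tendsto_slope`, `HasDerivWithinAt.congr_of_eventuallyEq`,
`HasDerivWithinAt.comp`, `uniqueDiffWithinAt_Ioi`, `integral_fintype_prod_eq_prod`,
`integral_inv_of_pos`, `abs_max_sub_max_le_max`, `abs_min_sub_min_le_max`,
`measurable_derivWithin_Ioi`, `intervalIntegral.integral_eq_sub_of_hasDeriv_right_of_le`,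
`intervalIntegral.norm_integral_le_of_norm_le_const`, `norm_setIntegral_le_of_norm_le_const`,
`LipschitzWith.of_dist_le_mul`, `integral_dirac`. Tree: `HeathBrownCubicTypeII` (`wMeas`, `wDeriv`,
`hbXi`; its `wDeriv_eq_zero` is the support statement); the coordinate-peeling pattern follows
`Literature/MathematicalPhysics/QuantumManyBody/PeriodicBoseGasPQ.lean` (`lintegral_lintegral_update`).
-/

noncomputable section

open MeasureTheory Set Filter Topology Finset
open scoped ENNReal

namespace Literature.NumberTheory.Sieve.CubicSieve

/-! ### A general box `∏_{i ≤ j} [a_i, b_i)` with positive lower corners -/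

section GeneralBox

variable {j : ℕ}

/-- Lebesgue measure on `ℝ^j` restricted to a box `∏ [a_i, b_i)` is the product of the restricted
one-dimensional measures (Mathlib's `Measure.restrict_pi_pi`). [folklore] -/
theorem volume_restrict_box (a b : Fin j → ℝ) :
    (volume : Measure (Fin j → ℝ)).restrict (Set.univ.pi fun i => Ico (a i) (b i)) =
      Measure.pi fun i => (volume : Measure ℝ).restrict (Ico (a i) (b i)) := by
  rw [volume_pi]
  exact Measure.restrict_pi_pi _ _

/-- **Tonelli on the last coordinate of a box**: for measurable `F ≥ 0`,
`∫_{∏_{i≤j}[a_i,b_i)} F = ∫_{∏_{i<j}[a_i,b_i)} ∫_{[a_j,b_j)} F(x', y) dy dx'` (`x = (x', y)` via `Fin.snoc`).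
[folklore] -/
theorem lintegral_box_eq_lintegral_snoc (a b : Fin (j + 1) → ℝ) {F : (Fin (j + 1) → ℝ) → ℝ≥0∞}
    (hF : Measurable F) :
    ∫⁻ x in Set.univ.pi fun i => Ico (a i) (b i), F x =
      ∫⁻ x' in Set.univ.pi fun i : Fin j => Ico (a (Fin.castSucc i)) (b (Fin.castSucc i)),
        ∫⁻ y in Ico (a (Fin.last j)) (b (Fin.last j)), F (Fin.snoc x' y) := by
  set μ : Fin (j + 1) → Measure ℝ := fun i => (volume : Measure ℝ).restrict (Ico (a i) (b i)) with hμ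
  set e := MeasurableEquiv.piFinSuccAbove (fun _ : Fin (j + 1) => ℝ) (Fin.last j) with he_def
  have he : MeasurePreserving e (Measure.pi μ)
      ((μ (Fin.last j)).prod (Measure.pi fun i => μ ((Fin.last j).succAbove i))) :=
    measurePreserving_piFinSuccAbove μ (Fin.last j)
  rw [volume_restrict_box, volume_restrict_box]
  have hFe : Measurable fun p : ℝ × (Fin j → ℝ) => F (e.symm p) := hF.comp e.symm.measurable
  rw [← he.symm.lintegral_comp_emb e.symm.measurableEmbedding, lintegral_prod_symm _ hFe.aemeasurable]
  simp only [he_def, MeasurableEquiv.piFinSuccAbove_symm_apply, hμ, Fin.succAbove_last]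
  refine lintegral_congr fun x' => lintegral_congr fun y => ?_
  change F (Fin.insertNth (Fin.last j) y x') = F (Fin.snoc x' y)
  rw [Fin.insertNth_last']

/-- `meas{y ∈ [c, d) : y ≤ u} = (min u d − c)⁺` (as `ENNReal.ofReal`). [folklore] -/
theorem volume_Ico_inter_le (c d u : ℝ) :
    volume {y : ℝ | y ∈ Ico c d ∧ y ≤ u} = ENNReal.ofReal (min u d - c) := by
  by_cases hud : u < d
  · have : {y : ℝ | y ∈ Ico c d ∧ y ≤ u} = Icc c u := by
      ext y
      simp only [mem_setOf_eq, Set.mem_Ico, Set.mem_Icc]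
      exact ⟨fun h => ⟨h.1.1, h.2⟩, fun h => ⟨⟨h.1, h.2.trans_lt hud⟩, h.2⟩⟩
    rw [this, Real.volume_Icc, min_eq_left hud.le]
  · rw [not_lt] at hud
    have : {y : ℝ | y ∈ Ico c d ∧ y ≤ u} = Ico c d := by
      ext y
      simp only [mem_setOf_eq, Set.mem_Ico]
      exact ⟨fun h => h.1, fun h => ⟨h, h.2.le.trans hud⟩⟩
    rw [this, Real.volume_Ico, min_eq_right hud]

/-- The slice in the last coordinate: `meas{y ∈ [c, d) : P y ≤ t} = (min (t/P) d − c)⁺` for `P > 0`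
(the function `ψ(t/P)` of the Fubini formula for `w`, p. 48). [folklore] -/
theorem volume_slice_le (c d : ℝ) {P : ℝ} (hP : 0 < P) (t : ℝ) :
    volume {y : ℝ | y ∈ Ico c d ∧ P * y ≤ t} = ENNReal.ofReal (min (t / P) d - c) := by
  have : {y : ℝ | y ∈ Ico c d ∧ P * y ≤ t} = {y : ℝ | y ∈ Ico c d ∧ y ≤ t / P} := by
    ext y; rw [mem_setOf_eq, mem_setOf_eq, le_div_iff₀ hP, mul_comm]
  rw [this, volume_Ico_inter_le]

/-- `{x ∈ ℝ^k : ∏ x_i ≤ t}` is measurable. [folklore] -/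
theorem measurableSet_prod_le (k : ℕ) (t : ℝ) :
    MeasurableSet {x : Fin k → ℝ | ∏ i, x i ≤ t} :=
  measurableSet_le (Finset.measurable_prod _ fun i _ => measurable_pi_apply i) measurable_const

/-- **Fubini for `w`** (p. 48): the measure of `{x ∈ ∏_{i≤j}[a_i,b_i) : ∏ x_i ≤ t}` is the integral over
the first `j` coordinates of the slice length `(min (t/∏x') b_j − a_j)⁺` in the last one (`a_i > 0`).
[cite: HeathBrownActa2001, §8 p. 48] -/
theorem volume_boxLE_eq_lintegral (a b : Fin (j + 1) → ℝ) (ha : ∀ i, 0 < a i) (t : ℝ) :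
    volume {x : Fin (j + 1) → ℝ | (∀ i, x i ∈ Ico (a i) (b i)) ∧ ∏ i, x i ≤ t} =
      ∫⁻ x' in Set.univ.pi fun i : Fin j => Ico (a (Fin.castSucc i)) (b (Fin.castSucc i)),
        ENNReal.ofReal (min (t / ∏ i, x' i) (b (Fin.last j)) - a (Fin.last j)) := by
  have hS : {x : Fin (j + 1) → ℝ | (∀ i, x i ∈ Ico (a i) (b i)) ∧ ∏ i, x i ≤ t} =
      {x | ∏ i, x i ≤ t} ∩ Set.univ.pi fun i => Ico (a i) (b i) := by
    ext x
    simp only [mem_setOf_eq, mem_inter_iff, mem_univ_pi]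
    exact and_comm
  have hmeas := measurableSet_prod_le (j + 1) t
  rw [hS, ← Measure.restrict_apply hmeas, ← lintegral_indicator_one hmeas,
    lintegral_box_eq_lintegral_snoc a b (measurable_one.indicator hmeas)]
  refine setLIntegral_congr_fun (MeasurableSet.univ_pi fun i => measurableSet_Ico) fun x' hx' => ?_
  have hP : 0 < ∏ i, x' i :=
    Finset.prod_pos fun i _ => (ha _).trans_le ((Set.mem_univ_pi.mp hx' i).1)
  have hmeas1 : MeasurableSet {y : ℝ | (∏ i, x' i) * y ≤ t} :=
    measurableSet_le (measurable_const.mul measurable_id) measurable_const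
  have hind : ∀ y : ℝ, ({x : Fin (j + 1) → ℝ | ∏ i, x i ≤ t}).indicator
      (1 : (Fin (j + 1) → ℝ) → ℝ≥0∞) (Fin.snoc x' y) = ({y : ℝ | (∏ i, x' i) * y ≤ t}).indicator 1 y := by
    intro y
    simp only [Set.indicator, mem_setOf_eq, Fin.prod_snoc, Pi.one_apply]
  simp_rw [hind]
  rw [lintegral_indicator_one hmeas1, Measure.restrict_apply hmeas1]
  have : {y : ℝ | (∏ i, x' i) * y ≤ t} ∩ Ico (a (Fin.last j)) (b (Fin.last j)) =
      {y : ℝ | y ∈ Ico (a (Fin.last j)) (b (Fin.last j)) ∧ (∏ i, x' i) * y ≤ t} := by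
    ext y
    simp only [mem_inter_iff, mem_setOf_eq]
    exact and_comm
  rw [this, volume_slice_le _ _ hP]

/-- `ofReal (max 0 z) = ofReal z`. [folklore] -/
theorem ofReal_max_zero (z : ℝ) : ENNReal.ofReal (max 0 z) = ENNReal.ofReal z := by
  rcases le_total 0 z with h | h
  · rw [max_eq_right h]
  · rw [max_eq_left h, ENNReal.ofReal_zero, ENNReal.ofReal_of_nonpos h]

/-- A box `∏ [a_i, b_i)` has finite Lebesgue measure. [folklore] -/
theorem volume_box_lt_top (a b : Fin j → ℝ) :
    volume (Set.univ.pi fun i : Fin j => Ico (a i) (b i)) < ⊤ := by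
  rw [Real.volume_pi_Ico]
  exact ENNReal.prod_lt_top fun i _ => ENNReal.ofReal_lt_top

/-- The slice length `x' ↦ (min (t/∏x') d − c)⁺` is measurable. [folklore] -/
theorem measurable_sliceFn (c d t : ℝ) :
    Measurable fun x' : Fin j → ℝ => max 0 (min (t / ∏ i, x' i) d - c) :=
  measurable_const.max (((measurable_const.div
    (Finset.measurable_prod _ fun i _ => measurable_pi_apply i)).min measurable_const).sub
      measurable_const)

/-- **`w` as a Bochner integral** over the first `j` coordinates: the real form of
`volume_boxLE_eq_lintegral`. [cite: HeathBrownActa2001, §8 p. 48] -/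
theorem toReal_volume_boxLE_eq_integral (a b : Fin (j + 1) → ℝ) (ha : ∀ i, 0 < a i) (t : ℝ) :
    (volume {x : Fin (j + 1) → ℝ | (∀ i, x i ∈ Ico (a i) (b i)) ∧ ∏ i, x i ≤ t}).toReal =
      ∫ x' in Set.univ.pi fun i : Fin j => Ico (a (Fin.castSucc i)) (b (Fin.castSucc i)),
        max 0 (min (t / ∏ i, x' i) (b (Fin.last j)) - a (Fin.last j)) := by
  rw [volume_boxLE_eq_lintegral a b ha t]
  symm
  rw [integral_eq_lintegral_of_nonneg_ae (Eventually.of_forall fun x' => le_max_left (0 : ℝ) _)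
    (measurable_sliceFn _ _ _).aestronglyMeasurable]
  simp_rw [ofReal_max_zero]

/-! #### The slice function `ψ(u) = max 0 (min u d − c)` and its right derivative -/

/-- The clamp `ψ(v) = (min v d − c)⁺ = meas{y ∈ [c, d) : y ≤ v}` has right derivative `1_{[c,d)}(u)`
at EVERY `u` (also at `u = c`, `u = d`, where it is not differentiable): the content of "since we chose
the right-hand derivative, this is correct even at the endpoints of the interval" (p. 49). [folklore] -/
theorem hasDerivWithinAt_clamp (c d u : ℝ) :
    HasDerivWithinAt (fun v => max 0 (min v d - c)) (if c ≤ u ∧ u < d then 1 else 0) (Ioi u) u := by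
  by_cases hu : c ≤ u ∧ u < d
  · rw [if_pos hu]
    have hev : (fun v => max 0 (min v d - c)) =ᶠ[𝓝[Ioi u] u] fun v => v - c := by
      have h1 : Iio d ∈ 𝓝[Ioi u] u := nhdsWithin_le_nhds (Iio_mem_nhds hu.2)
      filter_upwards [h1, self_mem_nhdsWithin] with v hv hv'
      rw [min_eq_left (le_of_lt hv), max_eq_right]
      have : u < v := hv'
      linarith [hu.1]
    refine HasDerivWithinAt.congr_of_eventuallyEq ((hasDerivWithinAt_id u _).sub_const c) hev ?_
    simp only [id_eq, min_eq_left hu.2.le, max_eq_right (sub_nonneg.mpr hu.1)]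
  · rw [if_neg hu]
    rw [not_and_or, not_le, not_lt] at hu
    rcases hu with hu | hu
    · have hev : (fun v => max 0 (min v d - c)) =ᶠ[𝓝[Ioi u] u] fun _ => (0 : ℝ) := by
        have h1 : Iio c ∈ 𝓝[Ioi u] u := nhdsWithin_le_nhds (Iio_mem_nhds hu)
        filter_upwards [h1] with v hv
        have : v < c := hv
        rw [max_eq_left]
        linarith [min_le_left v d]
      refine (hasDerivWithinAt_const u (Ioi u) (0 : ℝ)).congr_of_eventuallyEq hev ?_
      rw [max_eq_left]
      linarith [min_le_left u d]
    · have hev : (fun v => max 0 (min v d - c)) =ᶠ[𝓝[Ioi u] u] fun _ => max 0 (d - c) := by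
        filter_upwards [self_mem_nhdsWithin] with v hv
        have : u < v := hv
        rw [min_eq_right (hu.trans this.le)]
      refine (hasDerivWithinAt_const u (Ioi u) (max 0 (d - c))).congr_of_eventuallyEq hev ?_
      rw [min_eq_right hu]

/-- Right derivative of `s ↦ ψ(s/P)` at `t`, `P > 0`: `1_{[c,d)}(t/P) · P⁻¹`. [folklore] -/
theorem hasDerivWithinAt_clamp_div (c d : ℝ) {P : ℝ} (hP : 0 < P) (t : ℝ) :
    HasDerivWithinAt (fun s => max 0 (min (s / P) d - c))
      ((if c ≤ t / P ∧ t / P < d then 1 else 0) * P⁻¹) (Ioi t) t := by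
  have h1 : HasDerivWithinAt (fun s => s / P) P⁻¹ (Ioi t) t := by
    simpa [div_eq_mul_inv] using (hasDerivWithinAt_id t (Ioi t)).mul_const P⁻¹
  have h2 := hasDerivWithinAt_clamp c d (t / P)
  have h3 := h2.comp t h1 fun s hs => (div_lt_div_of_pos_right hs hP : t / P < s / P)
  simpa only [Function.comp_def] using h3

/-- The clamp `ψ` is `1`-Lipschitz. [folklore] -/
theorem abs_clamp_sub_clamp_le (c d u v : ℝ) :
    |max 0 (min u d - c) - max 0 (min v d - c)| ≤ |u - v| := by
  calc |max 0 (min u d - c) - max 0 (min v d - c)|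
      ≤ max |(0 : ℝ) - 0| |min u d - c - (min v d - c)| := abs_max_sub_max_le_max _ _ _ _
    _ = |min u d - min v d| := by rw [sub_self, abs_zero, sub_sub_sub_cancel_right, max_eq_right (abs_nonneg _)]
    _ ≤ max |u - v| |d - d| := abs_min_sub_min_le_max _ _ _ _
    _ = |u - v| := by rw [sub_self, abs_zero, max_eq_left (abs_nonneg _)]

/-- `ψ ≤ (d − c)⁺`. [folklore] -/
theorem clamp_le (c d u : ℝ) : max 0 (min u d - c) ≤ max 0 (d - c) :=
  max_le_max le_rfl (sub_le_sub_right (min_le_right _ _) _)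

/-- `(t, ∞) ∖ {t} = (t, ∞)`. [folklore] -/
theorem Ioi_diff_singleton_self (t : ℝ) : Ioi t \ {t} = Ioi t := by
  ext s
  simp only [Set.mem_sdiff, Set.mem_Ioi, Set.mem_singleton_iff]
  exact ⟨fun h => h.1, fun h => ⟨h, h.ne'⟩⟩

/-! #### The right derivative of `w` (dominated convergence) -/

/-- The slice length is integrable on the box of the first `j` coordinates. [folklore] -/
theorem integrableOn_sliceFn (a b : Fin (j + 1) → ℝ) (t : ℝ) :
    IntegrableOn (fun x' : Fin j → ℝ => max 0 (min (t / ∏ i, x' i) (b (Fin.last j)) - a (Fin.last j)))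
      (Set.univ.pi fun i : Fin j => Ico (a (Fin.castSucc i)) (b (Fin.castSucc i))) volume := by
  haveI : IsFiniteMeasure ((volume : Measure (Fin j → ℝ)).restrict
      (Set.univ.pi fun i : Fin j => Ico (a (Fin.castSucc i)) (b (Fin.castSucc i)))) :=
    ⟨by rw [Measure.restrict_apply_univ]; exact volume_box_lt_top _ _⟩
  refine Integrable.mono' (integrable_const (max 0 (b (Fin.last j) - a (Fin.last j))))
    (measurable_sliceFn _ _ _).aestronglyMeasurable (Eventually.of_forall fun x' => ?_)
  rw [Real.norm_eq_abs, abs_of_nonneg (le_max_left _ _)]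
  exact clamp_le _ _ _

/-- **The right derivative of `w`, general box** (p. 48): for a box `∏_{i≤j}[a_i,b_i)` with `a_i > 0`,
`t ↦ ∫_{box'} ψ(t/∏x') dx'` has at EVERY `t` the right derivative `∫_{box'} 1[a_j ≤ t/∏x' < b_j] (∏x')⁻¹ dx'`
(`box'` = the first `j` coordinates). Dominated convergence along `𝓝[>] t`: the difference quotients of
`ψ(·/∏x')` converge everywhere (`hasDerivWithinAt_clamp_div`) and are bounded by `(∏ a_i)⁻¹`.
[cite: HeathBrownActa2001, §8 p. 48] -/
theorem hasDerivWithinAt_integral_sliceFn (a b : Fin (j + 1) → ℝ) (ha : ∀ i, 0 < a i) (t : ℝ) :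
    HasDerivWithinAt
      (fun s => ∫ x' in Set.univ.pi fun i : Fin j => Ico (a (Fin.castSucc i)) (b (Fin.castSucc i)),
        max 0 (min (s / ∏ i, x' i) (b (Fin.last j)) - a (Fin.last j)))
      (∫ x' in Set.univ.pi fun i : Fin j => Ico (a (Fin.castSucc i)) (b (Fin.castSucc i)),
        (if a (Fin.last j) ≤ t / ∏ i, x' i ∧ t / ∏ i, x' i < b (Fin.last j) then 1 else 0) *
          (∏ i, x' i)⁻¹)
      (Ioi t) t := by
  set B := Set.univ.pi fun i : Fin j => Ico (a (Fin.castSucc i)) (b (Fin.castSucc i)) with hB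
  set c := a (Fin.last j)
  set d := b (Fin.last j)
  set G : ℝ → (Fin j → ℝ) → ℝ := fun s x' => max 0 (min (s / ∏ i, x' i) d - c) with hG
  set L : (Fin j → ℝ) → ℝ := fun x' =>
    (if c ≤ t / ∏ i, x' i ∧ t / ∏ i, x' i < d then 1 else 0) * (∏ i, x' i)⁻¹ with hL
  have hBm : MeasurableSet B := MeasurableSet.univ_pi fun i => measurableSet_Ico
  haveI hfin : IsFiniteMeasure ((volume : Measure (Fin j → ℝ)).restrict B) :=
    ⟨by rw [Measure.restrict_apply_univ]; exact volume_box_lt_top _ _⟩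
  set A : ℝ := ∏ i : Fin j, a (Fin.castSucc i) with hA
  have hA0 : 0 < A := Finset.prod_pos fun i _ => ha _
  have hPge : ∀ x' ∈ B, A ≤ ∏ i, x' i := fun x' hx' =>
    Finset.prod_le_prod (fun i _ => (ha _).le) fun i _ => (Set.mem_univ_pi.mp hx' i).1
  have hP0 : ∀ x' ∈ B, 0 < ∏ i, x' i := fun x' hx' => hA0.trans_le (hPge x' hx')
  have hGint : ∀ s, Integrable (G s) (volume.restrict B) := fun s => integrableOn_sliceFn a b s
  -- the slope of the integral is the integral of the slopes
  have hslope : ∀ s, slope (fun s => ∫ x' in B, G s x') t s = ∫ x' in B, slope (fun s => G s x') t s := by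
    intro s
    simp only [slope_def_module]
    rw [← integral_sub (hGint s) (hGint t), ← integral_smul]
  rw [hasDerivWithinAt_iff_tendsto_slope, Ioi_diff_singleton_self]
  suffices key : Tendsto (fun s => ∫ x' in B, slope (fun s => G s x') t s) (𝓝[>] t)
      (𝓝 (∫ x' in B, L x')) from key.congr fun s => (hslope s).symm
  refine tendsto_integral_filter_of_dominated_convergence (fun _ => A⁻¹) ?_ ?_ (integrable_const _) ?_
  · refine Eventually.of_forall fun s => ?_
    simp only [slope_def_module]
    exact (((measurable_sliceFn c d s).sub (measurable_sliceFn c d t)).const_smul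
      ((s - t)⁻¹ : ℝ)).aestronglyMeasurable
  · filter_upwards [self_mem_nhdsWithin] with s hs
    have hst : 0 < s - t := sub_pos.mpr hs
    refine (ae_restrict_iff' hBm).mpr (Eventually.of_forall fun x' hx' => ?_)
    have hP := hP0 x' hx'
    rw [slope_def_module, norm_smul, Real.norm_eq_abs, Real.norm_eq_abs, abs_inv, abs_of_pos hst, hG]
    dsimp only
    calc (s - t)⁻¹ * |max 0 (min (s / ∏ i, x' i) d - c) - max 0 (min (t / ∏ i, x' i) d - c)|
        ≤ (s - t)⁻¹ * |s / ∏ i, x' i - t / ∏ i, x' i| :=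
          mul_le_mul_of_nonneg_left (abs_clamp_sub_clamp_le _ _ _ _) (inv_nonneg.mpr hst.le)
      _ = (∏ i, x' i)⁻¹ := by
          rw [← sub_div, abs_div, abs_of_pos hst, abs_of_pos hP]
          field_simp
      _ ≤ A⁻¹ := by
          rw [inv_le_inv₀ hP hA0]; exact hPge x' hx'
  · refine (ae_restrict_iff' hBm).mpr (Eventually.of_forall fun x' hx' => ?_)
    have hP := hP0 x' hx'
    have hd := hasDerivWithinAt_clamp_div c d hP t
    rw [hasDerivWithinAt_iff_tendsto_slope, Ioi_diff_singleton_self] at hd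
    exact hd

/-! #### Bounds for the right derivative ((8.4)) -/

/-- A measurable function bounded on a box is integrable on it. [folklore] -/
theorem integrableOn_box_of_bounded (a b : Fin j → ℝ) {f : (Fin j → ℝ) → ℝ} (hf : Measurable f)
    {C : ℝ} (hC : ∀ x ∈ Set.univ.pi fun i : Fin j => Ico (a i) (b i), |f x| ≤ C) :
    IntegrableOn f (Set.univ.pi fun i : Fin j => Ico (a i) (b i)) volume := by
  haveI : IsFiniteMeasure ((volume : Measure (Fin j → ℝ)).restrict
      (Set.univ.pi fun i : Fin j => Ico (a i) (b i))) :=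
    ⟨by rw [Measure.restrict_apply_univ]; exact volume_box_lt_top _ _⟩
  refine Integrable.mono' (integrable_const C) hf.aestronglyMeasurable ?_
  refine (ae_restrict_iff' (MeasurableSet.univ_pi fun i => measurableSet_Ico)).mpr
    (Eventually.of_forall fun x hx => ?_)
  rw [Real.norm_eq_abs]
  exact hC x hx

/-- The window integrand `x' ↦ 1[c ≤ t/∏x' < d] (∏x')⁻¹` of the formula for `w'` is measurable. [folklore] -/
theorem measurable_windowFn (c d t : ℝ) :
    Measurable fun x' : Fin j → ℝ =>
      (if c ≤ t / ∏ i, x' i ∧ t / ∏ i, x' i < d then (1 : ℝ) else 0) * (∏ i, x' i)⁻¹ := by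
  have hP : Measurable fun x' : Fin j → ℝ => ∏ i, x' i :=
    Finset.measurable_prod _ fun i _ => measurable_pi_apply i
  have hq : Measurable fun x' : Fin j → ℝ => t / ∏ i, x' i := measurable_const.div hP
  refine Measurable.mul ?_ hP.inv
  refine Measurable.ite ?_ measurable_const measurable_const
  exact (measurableSet_le measurable_const hq).inter (measurableSet_lt hq measurable_const)

/-- **`∫_{∏[a_i,b_i)} (∏ x_i)⁻¹ dx = ∏ log(b_i/a_i)`** for `0 < a_i ≤ b_i` (for Heath-Brown's boxes each
factor is `∫_{J(m)} dx/x = ξ log X`, (8.4)). [cite: HeathBrownActa2001, §8 (8.4)] -/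
theorem integral_box_prod_inv (a b : Fin j → ℝ) (ha : ∀ i, 0 < a i) (hab : ∀ i, a i ≤ b i) :
    ∫ x in Set.univ.pi fun i : Fin j => Ico (a i) (b i), (∏ i, x i)⁻¹ =
      ∏ i, Real.log (b i / a i) := by
  have hfun : (fun x : Fin j → ℝ => (∏ i, x i)⁻¹) = fun x => ∏ i, (x i)⁻¹ :=
    funext fun x => (prod_inv_distrib _).symm
  rw [hfun]
  change ∫ x, ∏ i, (x i)⁻¹ ∂((volume : Measure (Fin j → ℝ)).restrict _) = _
  rw [volume_restrict_box, integral_fintype_prod_eq_prod (f := fun _ (y : ℝ) => y⁻¹)]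
  refine Finset.prod_congr rfl fun i _ => ?_
  rw [integral_Ico_eq_integral_Ioc, ← intervalIntegral.integral_of_le (hab i),
    integral_inv_of_pos (ha i) ((ha i).trans_le (hab i))]

/-- **(8.4), general box, lower bound**: `0 ≤ ∫_{box'} 1[c ≤ t/∏x' < d] (∏x')⁻¹ dx'`.
[cite: HeathBrownActa2001, §8 (8.4)] -/
theorem integral_windowFn_nonneg (a b : Fin j → ℝ) (ha : ∀ i, 0 < a i) (c d t : ℝ) :
    0 ≤ ∫ x' in Set.univ.pi fun i : Fin j => Ico (a i) (b i),
      (if c ≤ t / ∏ i, x' i ∧ t / ∏ i, x' i < d then (1 : ℝ) else 0) * (∏ i, x' i)⁻¹ := by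
  refine setIntegral_nonneg (MeasurableSet.univ_pi fun i => measurableSet_Ico) fun x' hx' => ?_
  have hP : 0 < ∏ i, x' i :=
    Finset.prod_pos fun i _ => (ha _).trans_le ((Set.mem_univ_pi.mp hx' i).1)
  refine mul_nonneg ?_ (inv_nonneg.mpr hP.le)
  split_ifs <;> norm_num

/-- **(8.4), general box, upper bound**: `∫_{∏_{i<j}[a_i,b_i)} 1[c ≤ t/∏x' < d] (∏x')⁻¹ dx' ≤ ∏_{i<j} log(b_i/a_i)`
(`0 < a_i ≤ b_i`). [cite: HeathBrownActa2001, §8 (8.4)] -/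
theorem integral_windowFn_le (a b : Fin j → ℝ) (ha : ∀ i, 0 < a i) (hab : ∀ i, a i ≤ b i)
    (c d t : ℝ) :
    ∫ x' in Set.univ.pi fun i : Fin j => Ico (a i) (b i),
      (if c ≤ t / ∏ i, x' i ∧ t / ∏ i, x' i < d then (1 : ℝ) else 0) * (∏ i, x' i)⁻¹ ≤
      ∏ i, Real.log (b i / a i) := by
  rw [← integral_box_prod_inv a b ha hab]
  set A : ℝ := ∏ i : Fin j, a i with hA
  have hA0 : 0 < A := Finset.prod_pos fun i _ => ha _
  have hPge : ∀ x' ∈ Set.univ.pi (fun i : Fin j => Ico (a i) (b i)), A ≤ ∏ i, x' i :=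
    fun x' hx' => Finset.prod_le_prod (fun i _ => (ha _).le) fun i _ => (Set.mem_univ_pi.mp hx' i).1
  have hP0 : ∀ x' ∈ Set.univ.pi (fun i : Fin j => Ico (a i) (b i)), 0 < ∏ i, x' i :=
    fun x' hx' => hA0.trans_le (hPge x' hx')
  have hinvle : ∀ x' ∈ Set.univ.pi (fun i : Fin j => Ico (a i) (b i)), (∏ i, x' i)⁻¹ ≤ A⁻¹ :=
    fun x' hx' => by rw [inv_le_inv₀ (hP0 x' hx') hA0]; exact hPge x' hx'
  refine setIntegral_mono_on ?_ ?_ (MeasurableSet.univ_pi fun i => measurableSet_Ico)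
    fun x' hx' => ?_
  · refine integrableOn_box_of_bounded a b (measurable_windowFn c d t) (C := A⁻¹) fun x' hx' => ?_
    have hP := hP0 x' hx'
    rw [abs_mul, abs_of_pos (inv_pos.mpr hP)]
    calc |(if c ≤ t / ∏ i, x' i ∧ t / ∏ i, x' i < d then (1 : ℝ) else 0)| * (∏ i, x' i)⁻¹
        ≤ 1 * (∏ i, x' i)⁻¹ := by
          refine mul_le_mul_of_nonneg_right ?_ (inv_nonneg.mpr hP.le)
          split_ifs <;> norm_num
      _ ≤ A⁻¹ := by rw [one_mul]; exact hinvle x' hx'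
  · refine integrableOn_box_of_bounded a b
      (Finset.measurable_prod _ fun i _ => measurable_pi_apply i).inv (C := A⁻¹) fun x' hx' => ?_
    rw [abs_of_pos (inv_pos.mpr (hP0 x' hx'))]
    exact hinvle x' hx'
  · have hP := hP0 x' hx'
    calc (if c ≤ t / ∏ i, x' i ∧ t / ∏ i, x' i < d then (1 : ℝ) else 0) * (∏ i, x' i)⁻¹
        ≤ 1 * (∏ i, x' i)⁻¹ := by
          refine mul_le_mul_of_nonneg_right ?_ (inv_nonneg.mpr hP.le)
          split_ifs <;> norm_num
      _ = (∏ i, x' i)⁻¹ := one_mul _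

/-! #### The Lipschitz estimate (8.3): `dx/x`-mass of a multiplicative window -/

/-- `∫_{(p, q]} dy/y = log(q/p)` as a Lebesgue integral, `0 < p ≤ q`. [folklore] -/
theorem lintegral_Ioc_inv {p q : ℝ} (hp : 0 < p) (hpq : p ≤ q) :
    ∫⁻ y in Ioc p q, ENNReal.ofReal y⁻¹ = ENNReal.ofReal (Real.log (q / p)) := by
  have hint : IntegrableOn (fun y : ℝ => y⁻¹) (Ioc p q) volume := by
    have h := (intervalIntegral.intervalIntegrable_inv (μ := volume) (a := p) (b := q) (f := id)
      (fun x hx => by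
        rw [Set.uIcc_of_le hpq] at hx
        exact (ne_of_gt (hp.trans_le hx.1) : (id x : ℝ) ≠ 0)) continuousOn_id)
    exact (intervalIntegrable_iff_integrableOn_Ioc_of_le hpq).mp h
  rw [← ofReal_integral_eq_lintegral_ofReal hint, ← intervalIntegral.integral_of_le hpq,
    integral_inv_of_pos hp (hp.trans_le hpq)]
  refine (ae_restrict_iff' measurableSet_Ioc).mpr (Eventually.of_forall fun y hy => ?_)
  exact inv_nonneg.mpr (hp.trans hy.1).le

/-- The one-dimensional multiplicative window: for `P > 0` and `0 < u₁ ≤ u₂`,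
`∫_{[c,d)} (P y)⁻¹ 1[u₁ < P y ≤ u₂] dy ≤ P⁻¹ log(u₂/u₁)` (the `y`-range is inside `(u₁/P, u₂/P]`, of
`dy/y`-mass `log(u₂/u₁)`). [cite: HeathBrownActa2001, §8 (8.3)] -/
theorem lintegral_inv_window_le (c d : ℝ) {P u₁ u₂ : ℝ} (hP : 0 < P) (hu₁ : 0 < u₁) (hu : u₁ ≤ u₂) :
    ∫⁻ y in Ico c d, ENNReal.ofReal ((P * y)⁻¹ * (if u₁ < P * y ∧ P * y ≤ u₂ then 1 else 0)) ≤
      ENNReal.ofReal P⁻¹ * ENNReal.ofReal (Real.log (u₂ / u₁)) := by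
  have hpq : u₁ / P ≤ u₂ / P := div_le_div_of_nonneg_right hu hP.le
  have hp : 0 < u₁ / P := div_pos hu₁ hP
  calc ∫⁻ y in Ico c d, ENNReal.ofReal ((P * y)⁻¹ * (if u₁ < P * y ∧ P * y ≤ u₂ then 1 else 0))
      ≤ ∫⁻ y in Ico c d, (Ioc (u₁ / P) (u₂ / P)).indicator
          (fun y => ENNReal.ofReal P⁻¹ * ENNReal.ofReal y⁻¹) y := by
        refine setLIntegral_mono' measurableSet_Ico fun y _ => ?_
        by_cases hw : u₁ < P * y ∧ P * y ≤ u₂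
        · have hy : y ∈ Ioc (u₁ / P) (u₂ / P) := by
            constructor
            · rw [div_lt_iff₀ hP, mul_comm]; exact hw.1
            · rw [le_div_iff₀ hP, mul_comm]; exact hw.2
          have hy0 : 0 < y := hp.trans hy.1
          rw [if_pos hw, mul_one, Set.indicator_of_mem hy, mul_inv,
            ENNReal.ofReal_mul (inv_nonneg.mpr hP.le)]
        · rw [if_neg hw, mul_zero, ENNReal.ofReal_zero]
          exact zero_le
    _ ≤ ∫⁻ y, (Ioc (u₁ / P) (u₂ / P)).indicator (fun y => ENNReal.ofReal P⁻¹ * ENNReal.ofReal y⁻¹) y :=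
        setLIntegral_le_lintegral _ _
    _ = ENNReal.ofReal P⁻¹ * ∫⁻ y in Ioc (u₁ / P) (u₂ / P), ENNReal.ofReal y⁻¹ := by
        rw [lintegral_indicator measurableSet_Ioc,
          lintegral_const_mul _ (measurable_inv.ennreal_ofReal)]
    _ = ENNReal.ofReal P⁻¹ * ENNReal.ofReal (Real.log (u₂ / u₁)) := by
        rw [lintegral_Ioc_inv hp hpq, div_div_div_cancel_right₀ hP.ne']

/-- The multiplicative-window integrand `x ↦ (∏x)⁻¹ 1[u₁ < ∏x ≤ u₂]` is measurable. [folklore] -/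
theorem measurable_mulWindowFn (u₁ u₂ : ℝ) :
    Measurable fun x : Fin j → ℝ =>
      (∏ i, x i)⁻¹ * (if u₁ < ∏ i, x i ∧ ∏ i, x i ≤ u₂ then (1 : ℝ) else 0) := by
  have hP : Measurable fun x : Fin j → ℝ => ∏ i, x i :=
    Finset.measurable_prod _ fun i _ => measurable_pi_apply i
  refine hP.inv.mul (Measurable.ite ?_ measurable_const measurable_const)
  exact (measurableSet_lt measurable_const hP).inter (measurableSet_le hP measurable_const)

/-- **The `dx/x`-mass of a multiplicative window in a box** (Lebesgue form): for `∏_{i≤j}[a_i,b_i)` with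
`a_i > 0` and `0 < u₁ ≤ u₂`, `∫_{box} (∏x)⁻¹ 1[u₁ < ∏x ≤ u₂] dx ≤ log(u₂/u₁) · ∫_{box'} (∏x')⁻¹ dx'`
(`box'` the first `j` coordinates) — the estimate behind (8.3). [cite: HeathBrownActa2001, §8 (8.3)] -/
theorem lintegral_box_mulWindow_le (a b : Fin (j + 1) → ℝ) (ha : ∀ i, 0 < a i) {u₁ u₂ : ℝ}
    (hu₁ : 0 < u₁) (hu : u₁ ≤ u₂) :
    ∫⁻ x in Set.univ.pi fun i => Ico (a i) (b i),
        ENNReal.ofReal ((∏ i, x i)⁻¹ * (if u₁ < ∏ i, x i ∧ ∏ i, x i ≤ u₂ then (1 : ℝ) else 0)) ≤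
      ENNReal.ofReal (Real.log (u₂ / u₁)) *
        ∫⁻ x' in Set.univ.pi fun i : Fin j => Ico (a (Fin.castSucc i)) (b (Fin.castSucc i)),
          ENNReal.ofReal (∏ i, x' i)⁻¹ := by
  rw [lintegral_box_eq_lintegral_snoc a b (measurable_mulWindowFn u₁ u₂).ennreal_ofReal,
    ← lintegral_const_mul' _ _ ENNReal.ofReal_ne_top]
  refine setLIntegral_mono' (MeasurableSet.univ_pi fun i => measurableSet_Ico) fun x' hx' => ?_
  have hP : 0 < ∏ i, x' i :=
    Finset.prod_pos fun i _ => (ha _).trans_le ((Set.mem_univ_pi.mp hx' i).1)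
  simp_rw [Fin.prod_snoc]
  calc ∫⁻ y in Ico (a (Fin.last j)) (b (Fin.last j)),
        ENNReal.ofReal (((∏ i, x' i) * y)⁻¹ * (if u₁ < (∏ i, x' i) * y ∧ (∏ i, x' i) * y ≤ u₂ then 1 else 0))
      ≤ ENNReal.ofReal (∏ i, x' i)⁻¹ * ENNReal.ofReal (Real.log (u₂ / u₁)) :=
        lintegral_inv_window_le _ _ hP hu₁ hu
    _ = ENNReal.ofReal (Real.log (u₂ / u₁)) * ENNReal.ofReal (∏ i, x' i)⁻¹ := mul_comm _ _

/-- **The `dx/x`-mass of a multiplicative window in a box** (real form):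
`∫_{∏_{i≤j}[a_i,b_i)} (∏x)⁻¹ 1[u₁ < ∏x ≤ u₂] dx ≤ log(u₂/u₁) ∏_{i<j} log(b_i/a_i)` for `0 < a_i ≤ b_i`,
`0 < u₁ ≤ u₂`. [cite: HeathBrownActa2001, §8 (8.3)] -/
theorem integral_box_mulWindow_le (a b : Fin (j + 1) → ℝ) (ha : ∀ i, 0 < a i) (hab : ∀ i, a i ≤ b i)
    {u₁ u₂ : ℝ} (hu₁ : 0 < u₁) (hu : u₁ ≤ u₂) :
    ∫ x in Set.univ.pi fun i => Ico (a i) (b i),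
        (∏ i, x i)⁻¹ * (if u₁ < ∏ i, x i ∧ ∏ i, x i ≤ u₂ then (1 : ℝ) else 0) ≤
      Real.log (u₂ / u₁) * ∏ i : Fin j, Real.log (b (Fin.castSucc i) / a (Fin.castSucc i)) := by
  have hBm : MeasurableSet (Set.univ.pi fun i : Fin (j + 1) => Ico (a i) (b i)) :=
    MeasurableSet.univ_pi fun i => measurableSet_Ico
  have hB'm : MeasurableSet (Set.univ.pi fun i : Fin j => Ico (a (Fin.castSucc i)) (b (Fin.castSucc i))) :=
    MeasurableSet.univ_pi fun i => measurableSet_Ico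
  have hlog : 0 ≤ Real.log (u₂ / u₁) := Real.log_nonneg (by rw [le_div_iff₀ hu₁, one_mul]; exact hu)
  -- nonnegativity of the integrands on the boxes
  have hnn : 0 ≤ᵐ[volume.restrict (Set.univ.pi fun i : Fin (j + 1) => Ico (a i) (b i))]
      fun x => (∏ i, x i)⁻¹ * (if u₁ < ∏ i, x i ∧ ∏ i, x i ≤ u₂ then (1 : ℝ) else 0) := by
    refine (ae_restrict_iff' hBm).mpr (Eventually.of_forall fun x hx => ?_)
    have hP : 0 < ∏ i, x i :=
      Finset.prod_pos fun i _ => (ha _).trans_le ((Set.mem_univ_pi.mp hx i).1)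
    exact mul_nonneg (inv_nonneg.mpr hP.le) (by split_ifs <;> norm_num)
  have hnn' : 0 ≤ᵐ[volume.restrict (Set.univ.pi fun i : Fin j => Ico (a (Fin.castSucc i)) (b (Fin.castSucc i)))]
      fun x' => (∏ i, x' i)⁻¹ := by
    refine (ae_restrict_iff' hB'm).mpr (Eventually.of_forall fun x hx => ?_)
    exact inv_nonneg.mpr (Finset.prod_pos fun i _ =>
      (ha _).trans_le ((Set.mem_univ_pi.mp hx i).1)).le
  have hint' : IntegrableOn (fun x' : Fin j → ℝ => (∏ i, x' i)⁻¹)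
      (Set.univ.pi fun i : Fin j => Ico (a (Fin.castSucc i)) (b (Fin.castSucc i))) volume := by
    set A : ℝ := ∏ i : Fin j, a (Fin.castSucc i) with hA
    have hA0 : 0 < A := Finset.prod_pos fun i _ => ha _
    refine integrableOn_box_of_bounded _ _
      (Finset.measurable_prod _ fun i _ => measurable_pi_apply i).inv (C := A⁻¹) fun x' hx' => ?_
    have hPge : A ≤ ∏ i, x' i :=
      Finset.prod_le_prod (fun i _ => (ha _).le) fun i _ => (Set.mem_univ_pi.mp hx' i).1
    have hP : 0 < ∏ i, x' i := hA0.trans_le hPge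
    rw [abs_of_pos (inv_pos.mpr hP), inv_le_inv₀ hP hA0]
    exact hPge
  rw [integral_eq_lintegral_of_nonneg_ae hnn (measurable_mulWindowFn u₁ u₂).aestronglyMeasurable,
    ← integral_box_prod_inv _ _ (fun i => ha _) (fun i => hab _),
    ← ENNReal.toReal_ofReal hlog, integral_eq_lintegral_of_nonneg_ae hnn'
      (Finset.measurable_prod _ fun i _ => measurable_pi_apply i).inv.aestronglyMeasurable,
    ← ENNReal.toReal_mul]
  refine ENNReal.toReal_mono (ENNReal.mul_ne_top ENNReal.ofReal_ne_top ?_)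
    (lintegral_box_mulWindow_le a b ha hu₁ hu)
  rw [← ofReal_integral_eq_lintegral_ofReal hint' hnn']
  exact ENNReal.ofReal_ne_top

/-- The window indicators at `t ≤ t'` differ only when `∏x = P` lies in one of the two multiplicative
windows `(t/c, t'/c]`, `(t/d, t'/d]` (`c, d, P > 0`):
`|1[c ≤ t'/P < d] − 1[c ≤ t/P < d]| ≤ 1[t/c < P ≤ t'/c] + 1[t/d < P ≤ t'/d]`. [folklore] -/
theorem abs_window_sub_window_le {c d P t t' : ℝ} (hc : 0 < c) (hd : 0 < d) (hP : 0 < P)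
    (htt : t ≤ t') :
    |(if c ≤ t' / P ∧ t' / P < d then (1 : ℝ) else 0) - (if c ≤ t / P ∧ t / P < d then (1 : ℝ) else 0)| ≤
      (if t / c < P ∧ P ≤ t' / c then (1 : ℝ) else 0) + (if t / d < P ∧ P ≤ t' / d then (1 : ℝ) else 0) := by
  have h1 : t / P ≤ t' / P := div_le_div_of_nonneg_right htt hP.le
  have hJ : ∀ (p : Prop) [Decidable p], (0 : ℝ) ≤ (if p then (1 : ℝ) else 0) := fun p _ => by
    split_ifs <;> norm_num
  have key : ∀ {e : ℝ}, 0 < e → t / P < e → e ≤ t' / P → (t / e < P ∧ P ≤ t' / e) := by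
    intro e he h h'
    rw [div_lt_iff₀ hP] at h
    rw [le_div_iff₀ hP] at h'
    exact ⟨by rw [div_lt_iff₀ he]; linarith, by rw [le_div_iff₀ he]; linarith⟩
  by_cases hA : c ≤ t' / P ∧ t' / P < d <;> by_cases hB : c ≤ t / P ∧ t / P < d
  · rw [if_pos hA, if_pos hB, sub_self, abs_zero]
    exact add_nonneg (hJ _) (hJ _)
  · rw [if_pos hA, if_neg hB, sub_zero, abs_one]
    have hlt : t / P < c := by
      by_contra hcon
      exact hB ⟨not_lt.mp hcon, h1.trans_lt hA.2⟩
    rw [if_pos (key hc hlt hA.1)]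
    linarith [hJ (t / d < P ∧ P ≤ t' / d)]
  · rw [if_neg hA, if_pos hB, zero_sub, abs_neg, abs_one]
    have hle : d ≤ t' / P := by
      by_contra hcon
      exact hA ⟨hB.1.trans h1, not_le.mp hcon⟩
    rw [if_pos (key hd hB.2 hle)]
    linarith [hJ (t / c < P ∧ P ≤ t' / c)]
  · rw [if_neg hA, if_neg hB, sub_self, abs_zero]
    exact add_nonneg (hJ _) (hJ _)

/-- **(8.3), general box**: for `0 < α_i ≤ β_i`, `c, d > 0` and `0 < t ≤ t'`, the window integral
`D(s) = ∫_{∏_{i≤j}[α_i,β_i)} 1[c ≤ s/∏x < d] (∏x)⁻¹ dx` satisfies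
`|D(t') − D(t)| ≤ 2 log(t'/t) ∏_{i<j} log(β_i/α_i)` ("`|w'(t+h) − w'(t)| ≤ (h/t) ∫_{𝐱∈∏J(m_i)} d𝐱/∏x_i`",
p. 48, with `log(t'/t) ≤ (t'−t)/t` and one window for each endpoint). [cite: HeathBrownActa2001, §8 (8.3)] -/
theorem abs_integral_windowFn_sub_le (α β : Fin (j + 1) → ℝ) (hα : ∀ i, 0 < α i)
    (hαβ : ∀ i, α i ≤ β i) {c d t t' : ℝ} (hc : 0 < c) (hd : 0 < d) (ht : 0 < t) (htt : t ≤ t') :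
    |(∫ x in Set.univ.pi fun i => Ico (α i) (β i),
        (if c ≤ t' / ∏ i, x i ∧ t' / ∏ i, x i < d then (1 : ℝ) else 0) * (∏ i, x i)⁻¹) -
      ∫ x in Set.univ.pi fun i => Ico (α i) (β i),
        (if c ≤ t / ∏ i, x i ∧ t / ∏ i, x i < d then (1 : ℝ) else 0) * (∏ i, x i)⁻¹| ≤
      2 * Real.log (t' / t) * ∏ i : Fin j, Real.log (β (Fin.castSucc i) / α (Fin.castSucc i)) := by
  set B := Set.univ.pi fun i : Fin (j + 1) => Ico (α i) (β i) with hB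
  have hBm : MeasurableSet B := MeasurableSet.univ_pi fun i => measurableSet_Ico
  set A : ℝ := ∏ i : Fin (j + 1), α i with hA
  have hA0 : 0 < A := Finset.prod_pos fun i _ => hα _
  have hPge : ∀ x ∈ B, A ≤ ∏ i, x i := fun x hx =>
    Finset.prod_le_prod (fun i _ => (hα _).le) fun i _ => (Set.mem_univ_pi.mp hx i).1
  have hP0 : ∀ x ∈ B, 0 < ∏ i, x i := fun x hx => hA0.trans_le (hPge x hx)
  have hinvle : ∀ x ∈ B, (∏ i, x i)⁻¹ ≤ A⁻¹ := fun x hx => by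
    rw [inv_le_inv₀ (hP0 x hx) hA0]; exact hPge x hx
  have hJ : ∀ (p : Prop) [Decidable p], |(if p then (1 : ℝ) else 0)| ≤ 1 := fun p _ => by
    split_ifs <;> norm_num
  have hint : ∀ s, IntegrableOn (fun x : Fin (j + 1) → ℝ =>
      (if c ≤ s / ∏ i, x i ∧ s / ∏ i, x i < d then (1 : ℝ) else 0) * (∏ i, x i)⁻¹) B volume := by
    intro s
    refine integrableOn_box_of_bounded α β (measurable_windowFn c d s) (C := A⁻¹) fun x hx => ?_
    rw [abs_mul, abs_of_pos (inv_pos.mpr (hP0 x hx))]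
    calc _ ≤ 1 * (∏ i, x i)⁻¹ := mul_le_mul_of_nonneg_right (hJ _) (inv_nonneg.mpr (hP0 x hx).le)
      _ ≤ A⁻¹ := by rw [one_mul]; exact hinvle x hx
  have hintW : ∀ u₁ u₂, IntegrableOn (fun x : Fin (j + 1) → ℝ =>
      (∏ i, x i)⁻¹ * (if u₁ < ∏ i, x i ∧ ∏ i, x i ≤ u₂ then (1 : ℝ) else 0)) B volume := by
    intro u₁ u₂
    refine integrableOn_box_of_bounded α β (measurable_mulWindowFn u₁ u₂) (C := A⁻¹) fun x hx => ?_
    rw [abs_mul, abs_of_pos (inv_pos.mpr (hP0 x hx))]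
    calc _ ≤ (∏ i, x i)⁻¹ * 1 := mul_le_mul_of_nonneg_left (hJ _) (inv_nonneg.mpr (hP0 x hx).le)
      _ ≤ A⁻¹ := by rw [mul_one]; exact hinvle x hx
  rw [← integral_sub (hint t') (hint t)]
  calc |∫ x in B, ((if c ≤ t' / ∏ i, x i ∧ t' / ∏ i, x i < d then (1 : ℝ) else 0) * (∏ i, x i)⁻¹ -
          (if c ≤ t / ∏ i, x i ∧ t / ∏ i, x i < d then (1 : ℝ) else 0) * (∏ i, x i)⁻¹)|
      ≤ ∫ x in B, |(if c ≤ t' / ∏ i, x i ∧ t' / ∏ i, x i < d then (1 : ℝ) else 0) * (∏ i, x i)⁻¹ -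
          (if c ≤ t / ∏ i, x i ∧ t / ∏ i, x i < d then (1 : ℝ) else 0) * (∏ i, x i)⁻¹| :=
        abs_integral_le_integral_abs
    _ ≤ ∫ x in B, ((∏ i, x i)⁻¹ * (if t / c < ∏ i, x i ∧ ∏ i, x i ≤ t' / c then (1 : ℝ) else 0) +
          (∏ i, x i)⁻¹ * (if t / d < ∏ i, x i ∧ ∏ i, x i ≤ t' / d then (1 : ℝ) else 0)) := by
        refine setIntegral_mono_on ((hint t').sub (hint t)).abs ((hintW _ _).add (hintW _ _)) hBm
          fun x hx => ?_
        have hP := hP0 x hx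
        rw [← sub_mul, abs_mul, abs_of_pos (inv_pos.mpr hP), ← mul_add, mul_comm]
        exact mul_le_mul_of_nonneg_left (abs_window_sub_window_le hc hd hP htt) (inv_nonneg.mpr hP.le)
    _ = (∫ x in B, (∏ i, x i)⁻¹ * (if t / c < ∏ i, x i ∧ ∏ i, x i ≤ t' / c then (1 : ℝ) else 0)) +
          ∫ x in B, (∏ i, x i)⁻¹ * (if t / d < ∏ i, x i ∧ ∏ i, x i ≤ t' / d then (1 : ℝ) else 0) :=
        integral_add (hintW _ _) (hintW _ _)
    _ ≤ Real.log (t' / c / (t / c)) * ∏ i : Fin j, Real.log (β (Fin.castSucc i) / α (Fin.castSucc i)) +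
          Real.log (t' / d / (t / d)) * ∏ i : Fin j, Real.log (β (Fin.castSucc i) / α (Fin.castSucc i)) :=
        add_le_add
          (integral_box_mulWindow_le α β hα hαβ (div_pos ht hc) (div_le_div_of_nonneg_right htt hc.le))
          (integral_box_mulWindow_le α β hα hαβ (div_pos ht hd) (div_le_div_of_nonneg_right htt hd.le))
    _ = 2 * Real.log (t' / t) * ∏ i : Fin j, Real.log (β (Fin.castSucc i) / α (Fin.castSucc i)) := by
        rw [div_div_div_cancel_right₀ hc.ne', div_div_div_cancel_right₀ hd.ne']
        ring

end GeneralBox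

/-! ### Specialisation to Heath-Brown's `w(t, 𝐦)` and `w'(t, 𝐦)` -/

section HB

variable {X τ : ℝ}

/-- The lower corners `X^{m_i ξ}` of Heath-Brown's box `∏ J(m_i)` are positive (`X > 0`). [folklore] -/
theorem hbBox_corner_pos (hX : 0 < X) {k : ℕ} (m : Fin k → ℕ) (i : Fin k) :
    0 < X ^ ((m i : ℝ) * hbXi τ) :=
  Real.rpow_pos_of_pos hX _

/-- **`w(t, 𝐦)` as an integral over the first `n` coordinates** (p. 48): for `𝐦` of length `n + 1` and
`X > 0`, `w(t) = ∫_{∏_{i≤n} J(m_i)} ψ(t/∏x') dx'` with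
`ψ(u) = meas{y ∈ J(m_{n+1}) : y ≤ u} = (min u X^{(m_{n+1}+1)ξ} − X^{m_{n+1}ξ})⁺`.
[cite: HeathBrownActa2001, §8 p. 48] -/
theorem wMeas_eq_integral (hX : 0 < X) {n : ℕ} (m : Fin (n + 1) → ℕ) (t : ℝ) :
    wMeas X τ m t =
      ∫ x' in Set.univ.pi fun i : Fin n =>
          Ico (X ^ ((m (Fin.castSucc i) : ℝ) * hbXi τ)) (X ^ (((m (Fin.castSucc i) : ℝ) + 1) * hbXi τ)),
        max 0 (min (t / ∏ i, x' i) (X ^ (((m (Fin.last n) : ℝ) + 1) * hbXi τ)) -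
          X ^ ((m (Fin.last n) : ℝ) * hbXi τ)) := by
  unfold wMeas
  exact toReal_volume_boxLE_eq_integral (fun i => X ^ ((m i : ℝ) * hbXi τ))
    (fun i => X ^ (((m i : ℝ) + 1) * hbXi τ)) (fun i => hbBox_corner_pos hX m i) t

/-- `w(·, 𝐦)` has, at every `t`, the right derivative `∫_{∏_{i≤n} J(m_i)} (∏x')⁻¹ 1[t/∏x' ∈ J(m_{n+1})] dx'`
(p. 48, in explicit form). [cite: HeathBrownActa2001, §8 p. 48] -/
theorem hasDerivWithinAt_wMeas_integral (hX : 0 < X) {n : ℕ} (m : Fin (n + 1) → ℕ) (t : ℝ) :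
    HasDerivWithinAt (wMeas X τ m)
      (∫ x' in Set.univ.pi fun i : Fin n =>
          Ico (X ^ ((m (Fin.castSucc i) : ℝ) * hbXi τ)) (X ^ (((m (Fin.castSucc i) : ℝ) + 1) * hbXi τ)),
        (if X ^ ((m (Fin.last n) : ℝ) * hbXi τ) ≤ t / ∏ i, x' i ∧
            t / ∏ i, x' i < X ^ (((m (Fin.last n) : ℝ) + 1) * hbXi τ) then (1 : ℝ) else 0) *
          (∏ i, x' i)⁻¹)
      (Ioi t) t := by
  have hfun : wMeas X τ m = fun s =>
      ∫ x' in Set.univ.pi fun i : Fin n =>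
          Ico (X ^ ((m (Fin.castSucc i) : ℝ) * hbXi τ)) (X ^ (((m (Fin.castSucc i) : ℝ) + 1) * hbXi τ)),
        max 0 (min (s / ∏ i, x' i) (X ^ (((m (Fin.last n) : ℝ) + 1) * hbXi τ)) -
          X ^ ((m (Fin.last n) : ℝ) * hbXi τ)) :=
    funext fun s => wMeas_eq_integral hX m s
  rw [hfun]
  exact hasDerivWithinAt_integral_sliceFn (fun i => X ^ ((m i : ℝ) * hbXi τ))
    (fun i => X ^ (((m i : ℝ) + 1) * hbXi τ)) (fun i => hbBox_corner_pos hX m i) t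

/-- **`w'(t, 𝐦)` as an integral** (p. 48, "`w'(t) = ∫ (I_t(t) − I_d(t)) dx_1⋯dx_{n−1}/(x_1⋯x_{n−1})`" in
the paper's notation): `w'(t) = ∫_{∏_{i≤n} J(m_i)} (∏x')⁻¹ 1[t/∏x' ∈ J(m_{n+1})] dx'`, for `𝐦` of length
`n + 1`, `X > 0` and every `t`. [cite: HeathBrownActa2001, §8 p. 48] -/
theorem wDeriv_eq_integral (hX : 0 < X) {n : ℕ} (m : Fin (n + 1) → ℕ) (t : ℝ) :
    wDeriv X τ m t =
      ∫ x' in Set.univ.pi fun i : Fin n =>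
          Ico (X ^ ((m (Fin.castSucc i) : ℝ) * hbXi τ)) (X ^ (((m (Fin.castSucc i) : ℝ) + 1) * hbXi τ)),
        (if X ^ ((m (Fin.last n) : ℝ) * hbXi τ) ≤ t / ∏ i, x' i ∧
            t / ∏ i, x' i < X ^ (((m (Fin.last n) : ℝ) + 1) * hbXi τ) then (1 : ℝ) else 0) *
          (∏ i, x' i)⁻¹ :=
  (hasDerivWithinAt_wMeas_integral hX m t).derivWithin (uniqueDiffWithinAt_Ioi t)

/-- **`w(·, 𝐦)` has right derivative `w'(·, 𝐦)` at every point** — the convention of p. 18 ("we define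
the derivative `w'(t)` to be the right-hand derivative, for precision") is realised by the tree's
`wDeriv = derivWithin _ (Ioi t) t`, for every length `n + 1 ≥ 1` and `X > 0`.
[cite: HeathBrownActa2001, §3 (3.12)] -/
theorem hasDerivWithinAt_wMeas (hX : 0 < X) {n : ℕ} (m : Fin (n + 1) → ℕ) (t : ℝ) :
    HasDerivWithinAt (wMeas X τ m) (wDeriv X τ m t) (Ioi t) t := by
  rw [wDeriv_eq_integral hX]
  exact hasDerivWithinAt_wMeas_integral hX m t

/-- `log(X^{(m+1)ξ}/X^{mξ}) = ξ log X` (`X > 0`): "`∫_{J(m)} dx/x = ξ log X`" (p. 48).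
[cite: HeathBrownActa2001, §8 (8.4)] -/
theorem log_hbBox_ratio (hX : 0 < X) (τ : ℝ) (m : ℕ) :
    Real.log (X ^ (((m : ℝ) + 1) * hbXi τ) / X ^ ((m : ℝ) * hbXi τ)) = hbXi τ * Real.log X := by
  rw [← Real.rpow_sub hX, Real.log_rpow hX]
  ring

/-- **(8.4), lower half**: `0 ≤ w'(t, 𝐦)` (`X > 0`). [cite: HeathBrownActa2001, §8 (8.4)] -/
theorem wDeriv_nonneg (hX : 0 < X) {n : ℕ} (m : Fin (n + 1) → ℕ) (t : ℝ) : 0 ≤ wDeriv X τ m t := by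
  rw [wDeriv_eq_integral hX]
  exact integral_windowFn_nonneg _ _ (fun i => hbBox_corner_pos hX m _) _ _ _

/-- **(8.4)**: "`0 ≤ w'(t) ≤ (ξ log X)^n`, since `∫_{J(m)} dx/x = ξ log X`" — for `𝐦` of length `n + 1`,
`X ≥ 1`, `τ ≥ 0` (so that `J(m_i)` is a genuine interval) and every `t`. [cite: HeathBrownActa2001, §8 (8.4)] -/
theorem wDeriv_le (hX : 1 ≤ X) (hτ : 0 ≤ τ) {n : ℕ} (m : Fin (n + 1) → ℕ) (t : ℝ) :
    wDeriv X τ m t ≤ (hbXi τ * Real.log X) ^ n := by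
  have hX0 : 0 < X := by linarith
  rw [wDeriv_eq_integral hX0]
  refine (integral_windowFn_le _ _ (fun i => hbBox_corner_pos hX0 m _) (fun i => ?_) _ _ _).trans ?_
  · exact Real.rpow_le_rpow_of_exponent_le hX (by
      have : 0 ≤ hbXi τ := pow_nonneg hτ 5
      nlinarith)
  · rw [Finset.prod_congr rfl fun i _ => log_hbBox_ratio hX0 τ (m (Fin.castSucc i)),
      Finset.prod_const, Finset.card_univ, Fintype.card_fin]

/-- **(8.3)**: "`|w'(t + h) − w'(t)| ≤ (h/t) ∫_{∏_{i<n}J(m_i)} d𝐱/∏x_i ≪ (h/t)(ξ log X)^{n−1}`" (p. 48, for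
vectors of length `n + 1`, `n ≥ 1`) — here for `𝐦` of length `n + 2` (so the printed exponent `n − 1`
reads `n`), `X ≥ 1`, `τ ≥ 0`, `0 < t ≤ t'`, in the sharper form `|w'(t') − w'(t)| ≤ 2 log(t'/t) (ξ log X)^n`.
[cite: HeathBrownActa2001, §8 (8.3)] -/
theorem abs_wDeriv_sub_wDeriv_le_log (hX : 1 ≤ X) (hτ : 0 ≤ τ) {n : ℕ} (m : Fin (n + 2) → ℕ)
    {t t' : ℝ} (ht : 0 < t) (htt : t ≤ t') :
    |wDeriv X τ m t' - wDeriv X τ m t| ≤ 2 * Real.log (t' / t) * (hbXi τ * Real.log X) ^ n := by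
  have hX0 : 0 < X := by linarith
  have hξ : 0 ≤ hbXi τ := pow_nonneg hτ 5
  rw [wDeriv_eq_integral hX0, wDeriv_eq_integral hX0]
  refine (abs_integral_windowFn_sub_le (fun i : Fin (n + 1) => X ^ ((m (Fin.castSucc i) : ℝ) * hbXi τ))
    (fun i => X ^ (((m (Fin.castSucc i) : ℝ) + 1) * hbXi τ)) (fun i => hbBox_corner_pos hX0 _ _)
    (fun i => Real.rpow_le_rpow_of_exponent_le hX (by nlinarith)) (hbBox_corner_pos hX0 m _)
    (Real.rpow_pos_of_pos hX0 _) ht htt).trans (le_of_eq ?_)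
  rw [Finset.prod_congr rfl fun i _ => log_hbBox_ratio hX0 τ (m (Fin.castSucc (Fin.castSucc i))),
    Finset.prod_const, Finset.card_univ, Fintype.card_fin]

/-- **(8.3)** in the printed shape `|w'(t + h) − w'(t)| ≪ (h/t)(ξ log X)^{n−1}` with the explicit constant
`2`: for `𝐦` of length `n + 2`, `X ≥ 1`, `τ ≥ 0`, `0 < t ≤ t'`,
`|w'(t') − w'(t)| ≤ 2((t' − t)/t)(ξ log X)^n`. [cite: HeathBrownActa2001, §8 (8.3)] -/
theorem abs_wDeriv_sub_wDeriv_le (hX : 1 ≤ X) (hτ : 0 ≤ τ) {n : ℕ} (m : Fin (n + 2) → ℕ)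
    {t t' : ℝ} (ht : 0 < t) (htt : t ≤ t') :
    |wDeriv X τ m t' - wDeriv X τ m t| ≤ 2 * ((t' - t) / t) * (hbXi τ * Real.log X) ^ n := by
  have hX0 : 0 < X := by linarith
  refine (abs_wDeriv_sub_wDeriv_le_log hX hτ m ht htt).trans ?_
  have hlog : Real.log (t' / t) ≤ (t' - t) / t := by
    have := Real.log_le_sub_one_of_pos (div_pos (ht.trans_le htt) ht)
    rwa [div_sub_one ht.ne'] at this
  have hpow : 0 ≤ (hbXi τ * Real.log X) ^ n :=
    pow_nonneg (mul_nonneg (pow_nonneg hτ 5) (Real.log_nonneg hX)) n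
  nlinarith

/-! #### Continuity of `w`, the fundamental theorem of calculus, and the case `n = 0` -/

/-- **`w(·, 𝐦)` is Lipschitz**: `|w(s) − w(t)| ≤ |s − t| · (∏_{i≤n} X^{m_iξ})⁻¹ · meas(∏_{i≤n} J(m_i))`
(`X > 0`; the slice length `ψ` is `1`-Lipschitz). [folklore] -/
theorem abs_wMeas_sub_wMeas_le (hX : 0 < X) {n : ℕ} (m : Fin (n + 1) → ℕ) (s t : ℝ) :
    |wMeas X τ m s - wMeas X τ m t| ≤
      |s - t| * (∏ i : Fin n, X ^ ((m (Fin.castSucc i) : ℝ) * hbXi τ))⁻¹ *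
        (volume (Set.univ.pi fun i : Fin n =>
          Ico (X ^ ((m (Fin.castSucc i) : ℝ) * hbXi τ)) (X ^ (((m (Fin.castSucc i) : ℝ) + 1) * hbXi τ)))).toReal := by
  set a : Fin (n + 1) → ℝ := fun i => X ^ ((m i : ℝ) * hbXi τ) with ha_def
  set b : Fin (n + 1) → ℝ := fun i => X ^ (((m i : ℝ) + 1) * hbXi τ) with hb_def
  have ha : ∀ i, 0 < a i := fun i => hbBox_corner_pos hX m i
  set B := Set.univ.pi fun i : Fin n => Ico (a (Fin.castSucc i)) (b (Fin.castSucc i)) with hB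
  have hBm : MeasurableSet B := MeasurableSet.univ_pi fun i => measurableSet_Ico
  set A : ℝ := ∏ i : Fin n, a (Fin.castSucc i) with hA
  have hA0 : 0 < A := Finset.prod_pos fun i _ => ha _
  have hPge : ∀ x ∈ B, A ≤ ∏ i, x i := fun x hx =>
    Finset.prod_le_prod (fun i _ => (ha _).le) fun i _ => (Set.mem_univ_pi.mp hx i).1
  have hP0 : ∀ x ∈ B, 0 < ∏ i, x i := fun x hx => hA0.trans_le (hPge x hx)
  rw [wMeas_eq_integral hX m s, wMeas_eq_integral hX m t,
    ← integral_sub (integrableOn_sliceFn a b s) (integrableOn_sliceFn a b t)]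
  have hbound : ∀ x ∈ B, ‖max 0 (min (s / ∏ i, x i) (b (Fin.last n)) - a (Fin.last n)) -
      max 0 (min (t / ∏ i, x i) (b (Fin.last n)) - a (Fin.last n))‖ ≤ |s - t| * A⁻¹ := by
    intro x hx
    have hP := hP0 x hx
    rw [Real.norm_eq_abs]
    calc _ ≤ |s / ∏ i, x i - t / ∏ i, x i| := abs_clamp_sub_clamp_le _ _ _ _
      _ = |s - t| * (∏ i, x i)⁻¹ := by rw [← sub_div, abs_div, abs_of_pos hP, div_eq_mul_inv]
      _ ≤ |s - t| * A⁻¹ := by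
          refine mul_le_mul_of_nonneg_left ?_ (abs_nonneg _)
          rw [inv_le_inv₀ hP hA0]; exact hPge x hx
  have h := norm_setIntegral_le_of_norm_le_const (volume_box_lt_top _ _) hbound
  rw [Real.norm_eq_abs] at h
  simpa [Measure.real, mul_assoc] using h

/-- `w(·, 𝐦)` is continuous (indeed Lipschitz; `X > 0`). [folklore] -/
theorem continuous_wMeas (hX : 0 < X) {n : ℕ} (m : Fin (n + 1) → ℕ) : Continuous (wMeas X τ m) := by
  set K : ℝ := (∏ i : Fin n, X ^ ((m (Fin.castSucc i) : ℝ) * hbXi τ))⁻¹ *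
    (volume (Set.univ.pi fun i : Fin n =>
      Ico (X ^ ((m (Fin.castSucc i) : ℝ) * hbXi τ)) (X ^ (((m (Fin.castSucc i) : ℝ) + 1) * hbXi τ)))).toReal
    with hK
  have hK0 : 0 ≤ K := mul_nonneg (inv_nonneg.mpr (Finset.prod_nonneg fun i _ =>
    (hbBox_corner_pos hX m _).le)) ENNReal.toReal_nonneg
  refine (LipschitzWith.of_dist_le_mul (K := K.toNNReal) fun s t => ?_).continuous
  rw [Real.dist_eq, Real.dist_eq, Real.coe_toNNReal _ hK0]
  have := abs_wMeas_sub_wMeas_le (τ := τ) hX m s t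
  rw [mul_assoc] at this
  linarith [this, mul_comm (|s - t|) K]

/-- `w'(·, 𝐦)` is measurable (a right derivative `t ↦ derivWithin f (Ioi t) t` always is, Mathlib's
`measurable_derivWithin_Ioi`). [folklore] -/
theorem measurable_wDeriv (X τ : ℝ) {k : ℕ} (m : Fin k → ℕ) : Measurable (wDeriv X τ m) :=
  measurable_derivWithin_Ioi (wMeas X τ m)

/-- `w'(·, 𝐦)` is interval integrable (`X ≥ 1`, `τ ≥ 0`: measurable and `0 ≤ w' ≤ (ξ log X)^n` by (8.4)).
[folklore] -/
theorem intervalIntegrable_wDeriv (hX : 1 ≤ X) (hτ : 0 ≤ τ) {n : ℕ} (m : Fin (n + 1) → ℕ) (t₁ t₂ : ℝ) :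
    IntervalIntegrable (wDeriv X τ m) volume t₁ t₂ := by
  have hX0 : 0 < X := by linarith
  refine intervalIntegrable_iff.mpr ?_
  haveI : IsFiniteMeasure ((volume : Measure ℝ).restrict (Set.uIoc t₁ t₂)) :=
    ⟨by rw [Measure.restrict_apply_univ, Set.uIoc, Real.volume_Ioc]; exact ENNReal.ofReal_lt_top⟩
  refine Integrable.mono' (integrable_const ((hbXi τ * Real.log X) ^ n))
    (measurable_wDeriv X τ m).aestronglyMeasurable (Eventually.of_forall fun t => ?_)
  rw [Real.norm_eq_abs, abs_of_nonneg (wDeriv_nonneg hX0 m t)]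
  exact wDeriv_le hX hτ m t

/-- **`w(t₂) − w(t₁) = ∫_{t₁}^{t₂} w'(t) dt`** for `t₁ ≤ t₂` (`X ≥ 1`, `τ ≥ 0`): the fundamental theorem
of calculus for the continuous function `w` and its right derivative `w'` (Mathlib's
`intervalIntegral.integral_eq_sub_of_hasDeriv_right_of_le`) — the exact form of the mean value step
of p. 65. [cite: HeathBrownActa2001, §10 p. 65] -/
theorem wMeas_sub_wMeas_eq_integral (hX : 1 ≤ X) (hτ : 0 ≤ τ) {n : ℕ} (m : Fin (n + 1) → ℕ)
    {t₁ t₂ : ℝ} (h : t₁ ≤ t₂) :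
    wMeas X τ m t₂ - wMeas X τ m t₁ = ∫ t in t₁..t₂, wDeriv X τ m t := by
  have hX0 : 0 < X := by linarith
  rw [intervalIntegral.integral_eq_sub_of_hasDeriv_right_of_le h (continuous_wMeas hX0 m).continuousOn
    (fun t _ => hasDerivWithinAt_wMeas hX0 m t) (intervalIntegrable_wDeriv hX hτ m t₁ t₂)]

/-- **The mean value step of p. 65** ("When `n ≥ 1` the Mean Value Theorem shows that
`w(3X³(1+η)/N(R)) − w(3X³/N(R)) = (3ηX³/N(R)) w'(λ)` for some `λ` … We may then use (8.3) to deduce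
that `w'(λ) = w'(3X³/N(R)) + O(η(ξ log X)^{n−1})`"), as one inequality: for `𝐦` of length `n + 2`,
`X ≥ 1`, `τ ≥ 0`, `0 < t ≤ t'`, `|w(t') − w(t) − (t' − t) w'(t)| ≤ 2((t' − t)²/t)(ξ log X)^n`.
[cite: HeathBrownActa2001, §10 p. 65] -/
theorem abs_wMeas_sub_sub_mul_wDeriv_le (hX : 1 ≤ X) (hτ : 0 ≤ τ) {n : ℕ} (m : Fin (n + 2) → ℕ)
    {t t' : ℝ} (ht : 0 < t) (htt : t ≤ t') :
    |wMeas X τ m t' - wMeas X τ m t - (t' - t) * wDeriv X τ m t| ≤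
      2 * ((t' - t) ^ 2 / t) * (hbXi τ * Real.log X) ^ n := by
  have hsub : wMeas X τ m t' - wMeas X τ m t - (t' - t) * wDeriv X τ m t =
      ∫ s in t..t', (wDeriv X τ m s - wDeriv X τ m t) := by
    rw [intervalIntegral.integral_sub (intervalIntegrable_wDeriv hX hτ m t t') intervalIntegrable_const,
      intervalIntegral.integral_const, wMeas_sub_wMeas_eq_integral hX hτ m htt, smul_eq_mul]
  rw [hsub]
  have hbound : ∀ s ∈ Set.uIoc t t', ‖wDeriv X τ m s - wDeriv X τ m t‖ ≤
      2 * ((t' - t) / t) * (hbXi τ * Real.log X) ^ n := by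
    intro s hs
    rw [Set.uIoc_of_le htt] at hs
    rw [Real.norm_eq_abs]
    refine (abs_wDeriv_sub_wDeriv_le hX hτ m ht hs.1.le).trans ?_
    have hpow : 0 ≤ (hbXi τ * Real.log X) ^ n :=
      pow_nonneg (mul_nonneg (pow_nonneg hτ 5) (Real.log_nonneg hX)) n
    have : (s - t) / t ≤ (t' - t) / t := div_le_div_of_nonneg_right (by linarith [hs.2]) ht.le
    nlinarith
  have h := intervalIntegral.norm_integral_le_of_norm_le_const hbound
  rw [Real.norm_eq_abs, abs_of_nonneg (sub_nonneg.mpr htt)] at h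
  refine h.trans (le_of_eq ?_)
  field_simp

/-- **The case `n = 0`**: for `𝐦 = (m_1)` of length one and `X > 0`, `w'(t, 𝐦)` is the indicator
function of `J(m_1) = [X^{m_1ξ}, X^{(m_1+1)ξ})` at EVERY `t` (p. 49: "`w'(t, 𝐦)` is just the
characteristic function of `J(m_1)`. (Since we chose the right-hand derivative, this is correct even
at the endpoints of the interval.)"; p. 18). [cite: HeathBrownActa2001, §8 p. 49] -/
theorem wDeriv_eq_indicator (hX : 0 < X) (m : Fin 1 → ℕ) (t : ℝ) :
    wDeriv X τ m t =
      if X ^ ((m 0 : ℝ) * hbXi τ) ≤ t ∧ t < X ^ (((m 0 : ℝ) + 1) * hbXi τ) then 1 else 0 := by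
  rw [wDeriv_eq_integral hX m t]
  have hvol : (volume : Measure (Fin 0 → ℝ)).restrict
      (Set.univ.pi fun i : Fin 0 =>
        Ico (X ^ ((m (Fin.castSucc i) : ℝ) * hbXi τ)) (X ^ (((m (Fin.castSucc i) : ℝ) + 1) * hbXi τ))) =
      Measure.dirac (fun _ => 0) := by
    rw [volume_restrict_box, Measure.pi_of_empty _ (fun _ => 0)]
  rw [hvol, integral_dirac]
  simp only [Finset.univ_eq_empty, Finset.prod_empty, div_one, inv_one, mul_one]
  rfl

/-- The case `n = 0` of the mean value step (p. 65), crude form valid always: for `𝐦` of length one,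
`X ≥ 1`, `τ ≥ 0` and `t₁ ≤ t₂`, `|w(t₂) − w(t₁) − (t₂ − t₁) w'(t₁)| ≤ t₂ − t₁` (as `0 ≤ w' ≤ 1`).
[cite: HeathBrownActa2001, §10 p. 65] -/
theorem abs_wMeas_sub_sub_mul_wDeriv_le_of_one (hX : 1 ≤ X) (hτ : 0 ≤ τ) (m : Fin 1 → ℕ)
    {t₁ t₂ : ℝ} (h : t₁ ≤ t₂) :
    |wMeas X τ m t₂ - wMeas X τ m t₁ - (t₂ - t₁) * wDeriv X τ m t₁| ≤ t₂ - t₁ := by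
  have hX0 : 0 < X := by linarith
  have hsub : wMeas X τ m t₂ - wMeas X τ m t₁ - (t₂ - t₁) * wDeriv X τ m t₁ =
      ∫ s in t₁..t₂, (wDeriv X τ m s - wDeriv X τ m t₁) := by
    rw [intervalIntegral.integral_sub (intervalIntegrable_wDeriv hX hτ m t₁ t₂) intervalIntegrable_const,
      intervalIntegral.integral_const, wMeas_sub_wMeas_eq_integral hX hτ m h, smul_eq_mul]
  rw [hsub]
  have hbound : ∀ s ∈ Set.uIoc t₁ t₂, ‖wDeriv X τ m s - wDeriv X τ m t₁‖ ≤ 1 := by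
    intro s _
    have h1 : ∀ u, 0 ≤ wDeriv X τ m u ∧ wDeriv X τ m u ≤ 1 := fun u =>
      ⟨wDeriv_nonneg hX0 m u, by simpa using wDeriv_le hX hτ m u⟩
    rw [Real.norm_eq_abs, abs_le]
    constructor <;> linarith [h1 s, h1 t₁]
  have h' := intervalIntegral.norm_integral_le_of_norm_le_const hbound
  rwa [Real.norm_eq_abs, abs_of_nonneg (sub_nonneg.mpr h), one_mul] at h'

/-- The case `n = 0` of the mean value step (p. 65), exact form: "A little thought then reveals that
`w(3X³(1+η)/N(R)) − w(3X³/N(R)) = (3ηX³/N(R)) w'(3X³/N(R))` unless one of the endpoints of `J(m_1)`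
lies in the interval between `3X³/N(R)` and `3X³(1+η)/N(R)`": for `𝐦` of length one, `X ≥ 1`, `τ ≥ 0`,
`t₁ ≤ t₂` and neither endpoint of `J(m_1)` in `(t₁, t₂]`, `w(t₂) − w(t₁) = (t₂ − t₁) w'(t₁)`.
[cite: HeathBrownActa2001, §10 p. 65] -/
theorem wMeas_sub_wMeas_eq_mul_wDeriv_of_one (hX : 1 ≤ X) (hτ : 0 ≤ τ) (m : Fin 1 → ℕ)
    {t₁ t₂ : ℝ} (h : t₁ ≤ t₂)
    (hlo : X ^ ((m 0 : ℝ) * hbXi τ) ∉ Set.Ioc t₁ t₂)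
    (hhi : X ^ (((m 0 : ℝ) + 1) * hbXi τ) ∉ Set.Ioc t₁ t₂) :
    wMeas X τ m t₂ - wMeas X τ m t₁ = (t₂ - t₁) * wDeriv X τ m t₁ := by
  have hX0 : 0 < X := by linarith
  have hconst : ∀ s ∈ Set.Icc t₁ t₂, wDeriv X τ m s = wDeriv X τ m t₁ := by
    intro s hs
    rw [wDeriv_eq_indicator hX0, wDeriv_eq_indicator hX0]
    have hiff : (X ^ ((m 0 : ℝ) * hbXi τ) ≤ s ∧ s < X ^ (((m 0 : ℝ) + 1) * hbXi τ)) ↔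
        (X ^ ((m 0 : ℝ) * hbXi τ) ≤ t₁ ∧ t₁ < X ^ (((m 0 : ℝ) + 1) * hbXi τ)) := by
      simp only [Set.mem_Ioc, not_and, not_le] at hlo hhi
      constructor
      · rintro ⟨h1, h2⟩
        refine ⟨?_, lt_of_le_of_lt hs.1 h2⟩
        by_contra hcon
        exact absurd (hlo (not_le.mp hcon)) (not_lt.mpr (h1.trans hs.2))
      · rintro ⟨h1, h2⟩
        refine ⟨h1.trans hs.1, ?_⟩
        by_contra hcon
        exact absurd (hhi h2) (not_lt.mpr ((not_lt.mp hcon).trans hs.2))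
    rw [if_congr hiff rfl rfl]  -- hmm
  rw [wMeas_sub_wMeas_eq_integral hX hτ m h,
    intervalIntegral.integral_congr (g := fun _ => wDeriv X τ m t₁) (fun s hs => hconst s (by
      rwa [Set.uIcc_of_le h] at hs)),
    intervalIntegral.integral_const, smul_eq_mul]

end HB

end Literature.NumberTheory.Sieve.CubicSieve

end
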